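import Literature.AnabelianGeometry.AbsoluteAnabelian.AbsTopIII.KummerFaithfulRationalRootsProofs
import Literature.AnabelianGeometry.AbsoluteAnabelian.AbsTopIII.KummerFaithfulPurelyTranscendentalSubfieldsProofs
import Literature.AnabelianGeometry.AbsoluteAnabelian.AbsTopIII.KummerFaithfulPurelyTranscendentalProofs
import Literature.AnabelianGeometry.AbsoluteAnabelian.AbsTopIII.KummerFaithfulSubpadicHolds
import Literature.AlgebraicGeometry.Motives.AbelianVarietyBaseChange
import Literature.AlgebraicGeometry.Motives.AbelianVarietyBlochFiltrationTransfer
import HarnessLib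

/-!
# [AbsTopIII] Rmk. 1.5.4 (iii) REDUCED TO DESCENT: `ℚ_p(x_i)_{i ∈ I}` is Kummer-faithful, granted that an abelian variety and a point descend to a finitely generated subfield

Mochizuki, *Topics in Absolute Anabelian Geometry III*, §1, Remark 1.5.4 (iii), p. 34 (lit key
`paper:url-5493eb38cbb7`), verbatim: "observe that if, for instance, `I` is an infinite set, then the
field `k := ℚ_p(x_i)_{i ∈ I}` [which is not a finitely generated extension of `ℚ_p`] constitutes an
example of a Kummer-faithful field which is not sub-`p`-adic. Indeed, if, for `H`, `A` as in
Definition 1.5, `0 ≠ f ∈ A(k_H)` lies in the kernel of the associated Kummer map, then observe that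
there exists some finite subset `I′ ⊆ I` such that if we set `k′ := ℚ_p(x_i)_{i ∈ I′}`, then, for some
finite extension `k′_H ⊆ k_H` of `k′`, we may assume that `A` descends to a semi-abelian variety `A′`
over `k′_H`, that `f ∈ A′(k′_H) ⊆ A(k_H)`, and that `k_H = k′_H(x_i)_{i ∈ I″}`, where we set
`I″ := I ∖ I′`. Since `k′_H` is algebraically closed in `k_H`, it thus follows that all roots of `f`
defined over `k_H` are in fact defined over `k′_H`. Thus, the existence of `f` contradicts the fact
that the sub-`p`-adic field `k′_H` is Kummer-faithful."  (Gloss, not print: `k_H = k′_H(x_i)_{i ∈ I″}`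
says that `k_H` is purely transcendental over the finitely generated field `k′_H`.)

PROOF-ONLY file; route memo F0371-AV-ROUTE (cell abc-iut), junction J5 = ASSEMBLY, CONDITIONAL on
the one junction not in the tree (J1, EGA IV₃ 8.8.2 descent):

* hypothesis `hdesc` (J1, "an abelian variety together with a rational point is defined over a
  finitely generated field", Milne, *Abelian Varieties*, Rem. 20.9, first sentence of the proof):
  for every field `k'` of characteristic `0`, every abelian variety `A / k'` and every `x ∈ A(k')`
  there are an intermediate field `E₀` of `k' / ℚ`, finitely generated over `ℚ`, an abelian variety
  `A₀ / E₀`, a point `x₀ ∈ A₀(E₀)` and an isomorphism of abelian varieties `e : A ≅ A₀ ×_{E₀} k'` with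
  `e(x) = (x₀)_{k'}` (under `A₀ ×_{E₀} k' (k') = A₀(k')`, `AbelianVariety.pointsMulEquiv`);
* `divisibleElementsTrivial_points_of_finite_mvPolynomial_of_descent` — granted `hdesc`, condition
  (a) of Def. 1.5 for every abelian variety over every FINITE extension `k'` of
  `K_I = Frac ℚ_p[x_i]_{i ∈ I}` (any `I`): with `E₀, A₀, x₀, e` from `hdesc`, enlarge `E₀` to a
  finitely generated `E_J ⊆ k'` RELATIVELY ALGEBRAICALLY CLOSED in `k'` (J2,
  `exists_fg_intermediateField_relAlgClosed`); over `A₁ := A₀ ×_{E₀} E_J` the point is `E_J`-rational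
  and, `[N]` being finite, so is every `k'`-rational `N`-th root of it (J3/J4,
  `AbelianVariety.exists_eq_extendScalars_of_pow_eq`); `E_J` is finitely generated over `ℚ_p`,
  hence Kummer-faithful by Rmk. 1.5.4 (i) = F-0369 (`isKummerFaithful_of_fg_padic`,
  `KummerFaithfulSubpadicHolds`), so a divisible `x` is trivial;
* `Rmk_1_5_4_iii_of_descent` — **F-0371 `Rmk_1_5_4_iii` granted `hdesc`**
  (`Rmk_1_5_4_iii_of_abelianVariety_clause`, `KummerFaithfulPurelyTranscendentalProofs`: the torus
  clause and "not sub-`p`-adic" are proved there).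

Also here (bookkeeping over a tower `K ⊆ E' ⊆ k'`): `AbelianVariety.pointsEquivTower`
(`A(k') ≃ (A ×_K E')(k')`, multiplicative, compatible with the projection and with scalar extension
of `E'`-points). HONEST FRAMING: F-0371 is NOT closed by this file; its residual is exactly `hdesc`.  (The row was
meanwhile closed UNCONDITIONALLY by `Rmk_1_5_4_iii_holds`, `KummerFaithfulRmk154iiiHolds.lean`,
abc-iut-f-078/f-072, via "no new points in purely transcendental extensions"; the present file is the
printed route "all roots of `f` defined over `k_H` are in fact defined over `k′_H`", kept for its tower
bookkeeping and as a second route.)  Nothing here bears on [IUTchIII] Cor. 3.12.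
v2: module docstring re-quoted VERBATIM from p. 34 (RQ7 note abc-iut-aud-15); declarations unchanged.
-/

noncomputable section

universe u

open CategoryTheory CategoryTheory.Limits AlgebraicGeometry
open scoped MonObj CategoryTheory.Obj

namespace Literature.AnabelianGeometry.AbsoluteAnabelian.AbsTopIII

open Literature.AlgebraicGeometry.Motives Literature.AlgebraicGeometry.Motives.AlgPoints

/-! ### Points over a tower `K ⊆ E' ⊆ L`: `A(L) = (A ×_K E')(L)` -/

section Tower

variable {K : Type u} [Field K] (A : AbelianVariety K) (E' : Type u) [Field E'] [Algebra K E']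
  (L : Type u) [Field L] [Algebra K L] [Algebra E' L] [IsScalarTower K E' L]

/-- `Spec L` as a `K`-scheme is `Spec L` over `E'` pushed forward along `Spec E' → Spec K`
(the tower `K → E' → L`). [cite: MochizukiAbsTopIII2015, Rmk 1.5.4 (iii) p.34] -/
def specOverIsoMapObjTower :
    specOver K L ≅ (Over.map (AbelianVariety.bcSpec K E')).obj (specOver E' L) :=
  Over.isoMk (Iso.refl _) (by
    change 𝟙 _ ≫ Spec.map _ ≫ Spec.map _ = Spec.map _
    rw [Category.id_comp, ← Spec.map_comp, ← CommRingCat.ofHom_comp,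
      ← IsScalarTower.algebraMap_eq K E' L])

/-- **`A(L) ≃ (A ×_K E')(L)`** for a tower `K ⊆ E' ⊆ L`: the universal property of the fibre
product (Mathlib `Over.mapPullbackAdj`), as in `AbelianVariety.pointsEquiv` (the case `E' = L`).
[cite: MochizukiAbsTopIII2015, Rmk 1.5.4 (iii) p.34] -/
def _root_.Literature.AlgebraicGeometry.Motives.AbelianVariety.pointsEquivTower : A.Points L ≃ (A.baseChange E').Points L :=
  ((specOverIsoMapObjTower E' L).homCongr (Iso.refl A.X)).trans
    ((Over.mapPullbackAdj (AbelianVariety.bcSpec K E')).homEquiv (specOver E' L) A.X)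

/-- `pointsEquivTower` via the unit of `Over.map ⊣ Over.pullback`. [cite: MochizukiAbsTopIII2015, Rmk 1.5.4 (iii) p.34] -/
theorem _root_.Literature.AlgebraicGeometry.Motives.AbelianVariety.pointsEquivTower_apply (P : A.Points L) :
    A.pointsEquivTower E' L P =
      (Over.mapPullbackAdj (AbelianVariety.bcSpec K E')).unit.app (specOver E' L) ≫
        (AbelianVariety.bcFunctor K E').map ((specOverIsoMapObjTower E' L).inv ≫ P) := by
  simp only [AbelianVariety.pointsEquivTower, Equiv.trans_apply, Iso.homCongr_apply, Iso.refl_hom,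
    Category.comp_id]
  rfl

/-- The point of `(A ×_K E')(L)` attached to `P ∈ A(L)` lies over `P`.
[cite: MochizukiAbsTopIII2015, Rmk 1.5.4 (iii) p.34] -/
theorem _root_.Literature.AlgebraicGeometry.Motives.AbelianVariety.pointsEquivTower_symm_apply_left (Q : (A.baseChange E').Points L) :
    ((A.pointsEquivTower E' L).symm Q).left =
      Q.left ≫ pullback.fst A.X.hom (AbelianVariety.bcSpec K E') := by
  simp only [AbelianVariety.pointsEquivTower, Equiv.symm_trans_apply, Iso.homCongr_symm,
    Iso.homCongr_apply, Iso.refl_symm, Iso.refl_hom, Category.comp_id, Over.comp_left]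
  erw [Adjunction.homEquiv_counit]
  simp [specOverIsoMapObjTower]
  exact Category.id_comp _

/-- The point of `(A ×_K E')(L)` attached to `P ∈ A(L)` lies over `P`.
[cite: MochizukiAbsTopIII2015, Rmk 1.5.4 (iii) p.34] -/
theorem _root_.Literature.AlgebraicGeometry.Motives.AbelianVariety.pointsEquivTower_apply_left_comp_fst (P : A.Points L) :
    (A.pointsEquivTower E' L P).left ≫ pullback.fst A.X.hom (AbelianVariety.bcSpec K E') = P.left := by
  rw [← AbelianVariety.pointsEquivTower_symm_apply_left, Equiv.symm_apply_apply]

/-- `A(L) ≃ (A ×_K E')(L)` is multiplicative. [cite: MochizukiAbsTopIII2015, Rmk 1.5.4 (iii) p.34] -/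
theorem _root_.Literature.AlgebraicGeometry.Motives.AbelianVariety.pointsEquivTower_mul (P Q : A.Points L) :
    A.pointsEquivTower E' L (P * Q) = A.pointsEquivTower E' L P * A.pointsEquivTower E' L Q := by
  rw [AbelianVariety.pointsEquivTower_apply, AbelianVariety.pointsEquivTower_apply,
    AbelianVariety.pointsEquivTower_apply, MonObj.comp_mul, Functor.map_mul]
  exact MonObj.comp_mul _ _ _

/-- Scalar extension of `E'`-points of `A ×_K E'` to `L` corresponds, under `pointsEquivTower` and
`pointsEquiv`, to scalar extension of the underlying `K`-scheme points: for `P ∈ A(E')`,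
`pointsEquivTower (P_L) = (pointsEquiv P)_L` (both are determined by their composites with the two
projections of `A ×_K E'`). [cite: MochizukiAbsTopIII2015, Rmk 1.5.4 (iii) p.34] -/
theorem _root_.Literature.AlgebraicGeometry.Motives.AbelianVariety.pointsEquivTower_extendScalars (P : A.Points E') :
    A.pointsEquivTower E' L (extendScalars A.X E' L P) =
      extendScalars (A.baseChange E').X E' L (A.pointsEquiv E' P) := by
  apply Over.OverMorphism.ext
  apply pullback.hom_ext
  · have h1 := AbelianVariety.pointsEquivTower_apply_left_comp_fst A E' L (extendScalars A.X E' L P)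
    have h2 := AbelianVariety.pointsEquiv_apply_left_comp_fst E' A P
    refine h1.trans ?_
    exact ((Category.assoc _ _ _).trans
      (congrArg (fun g => Spec.map (CommRingCat.ofHom (algebraMap E' L)) ≫ g) h2)).symm
  · have h1 := Over.w (A.pointsEquivTower E' L (extendScalars A.X E' L P))
    have h2 := Over.w (extendScalars (A.baseChange E').X E' L (A.pointsEquiv E' P))
    exact h1.trans h2.symm

end Tower

/-! ### Scalar extension along a tower -/

section Ext

variable {K : Type u} [Field K] (X : SchemeOver K) (E' : Type u) [Field E'] [Algebra K E']
  (L : Type u) [Field L] [Algebra K L] [Algebra E' L] [IsScalarTower K E' L]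

/-- Transitivity of scalar extension of points along `K ⊆ E' ⊆ L`.
[cite: MochizukiAbsTopIII2015, Rmk 1.5.4 (iii) p.34] -/
theorem _root_.Literature.AlgebraicGeometry.Motives.AlgPoints.extendScalars_extendScalars (P : AlgPoints X K) :
    extendScalars X E' L (extendScalars X K E' P) = extendScalars X K L P := by
  apply Over.OverMorphism.ext
  change Spec.map _ ≫ Spec.map _ ≫ P.left = Spec.map _ ≫ P.left
  rw [← Spec.map_comp_assoc, ← CommRingCat.ofHom_comp, ← IsScalarTower.algebraMap_eq K E' L]

end Ext


/-! ### F-0371 granted descent -/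

section Assembly

/-- **Condition (a) of Def. 1.5 for abelian varieties over FINITE extensions of `ℚ_p(x_i)_{i ∈ I}`,
granted the descent of an abelian variety with a point to a finitely generated subfield** (J1 of
route F0371-AV-ROUTE, the hypothesis `hdesc`; everything else is proved: J2 relatively algebraically
closed finitely generated subfields, J3/J4 descent of `N`-th roots through the finite `[N]`, and
F-0369 = Rmk. 1.5.4 (i) for the finitely generated field `E_J`). This is the abelian-variety half of
[AbsTopIII] Rmk. 1.5.4 (iii) p. 34 ("we may assume that `A` descends to a semi-abelian variety `A′` over
`k′_H`, that `f ∈ A′(k′_H) ⊆ A(k_H)`, and that `k_H = k′_H(x_i)_{i ∈ I″}` [...] all roots of `f`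
defined over `k_H` are in fact defined over `k′_H`. Thus, the existence of `f` contradicts the fact that
the sub-`p`-adic field `k′_H` is Kummer-faithful").
The hypothesis `hdesc` is stated on POINTS: a multiplicative identification `A(k') ≃* A₀(k')`
carrying `x` to the scalar extension of an `E₀`-point (obtained in practice from an isomorphism
`A ≅ A₀ ×_{E₀} k'` via `AbelianVariety.pointsMap` and `AbelianVariety.pointsMulEquiv`).
[cite: MochizukiAbsTopIII2015, Rmk 1.5.4 (iii) p.34] -/
theorem divisibleElementsTrivial_points_of_finite_mvPolynomial_of_descent
    (hdesc : ∀ (k' : Type) [Field k'] [CharZero k'] (A : AbelianVariety k') (x : A.Points k'),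
      ∃ (E₀ : IntermediateField ℚ k') (_ : E₀.FG) (A₀ : AbelianVariety E₀) (x₀ : A₀.Points E₀)
        (Φ : A.Points k' ≃* A₀.Points k'), Φ x = extendScalars A₀.X E₀ k' x₀)
    (p : ℕ) [Fact p.Prime] (I : Type) (k' : Type) [Field k']
    [Algebra (FractionRing (MvPolynomial I ℚ_[p])) k']
    [Module.Finite (FractionRing (MvPolynomial I ℚ_[p])) k'] (A : AbelianVariety k') :
    DivisibleElementsTrivial (A.Points k') := by
  classical
  -- `k'` as a `ℚ_p`-algebra; characteristic zero
  letI : Algebra ℚ_[p] k' :=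
    ((algebraMap (FractionRing (MvPolynomial I ℚ_[p])) k').comp
      (algebraMap ℚ_[p] (FractionRing (MvPolynomial I ℚ_[p])))).toAlgebra
  haveI : IsScalarTower ℚ_[p] (FractionRing (MvPolynomial I ℚ_[p])) k' :=
    IsScalarTower.of_algebraMap_eq (fun _ => rfl)
  haveI : CharZero k' := charZero_of_injective_algebraMap (algebraMap ℚ_[p] k').injective
  -- the variables, viewed in `k'`: algebraically independent over `ℚ_p`, `k'` finite over `ℚ_p(z)`
  let θ : MvPolynomial I ℚ_[p] →ₐ[ℚ_[p]] k' :=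
    (IsScalarTower.toAlgHom ℚ_[p] (FractionRing (MvPolynomial I ℚ_[p])) k').comp
      (IsScalarTower.toAlgHom ℚ_[p] (MvPolynomial I ℚ_[p]) (FractionRing (MvPolynomial I ℚ_[p])))
  have hθapply : ∀ a, θ a = algebraMap (FractionRing (MvPolynomial I ℚ_[p])) k'
      (algebraMap (MvPolynomial I ℚ_[p]) (FractionRing (MvPolynomial I ℚ_[p])) a) := fun _ => rfl
  have hθ : Function.Injective θ := by
    intro a c h
    rw [hθapply, hθapply] at h
    exact IsFractionRing.injective (MvPolynomial I ℚ_[p]) (FractionRing (MvPolynomial I ℚ_[p]))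
      ((algebraMap (FractionRing (MvPolynomial I ℚ_[p])) k').injective h)
  let z : I → k' := fun i => θ (MvPolynomial.X i)
  have haeval : MvPolynomial.aeval z = θ := MvPolynomial.algHom_ext fun i => by simp [z]
  have hz : AlgebraicIndependent ℚ_[p] z := by
    rw [algebraicIndependent_iff_injective_aeval, haeval]
    exact hθ
  have hθmem : ∀ a : MvPolynomial I ℚ_[p], θ a ∈ IntermediateField.adjoin ℚ_[p] (Set.range z) :=
    fun a => by
    have h1 : θ a ∈ Algebra.adjoin ℚ_[p] (Set.range z) := by
      rw [Algebra.adjoin_range_eq_range_aeval, haeval]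
      exact ⟨a, rfl⟩
    exact IntermediateField.algebra_adjoin_le_adjoin ℚ_[p] _ h1
  have hKmem : ∀ x : FractionRing (MvPolynomial I ℚ_[p]),
      algebraMap (FractionRing (MvPolynomial I ℚ_[p])) k' x ∈
        IntermediateField.adjoin ℚ_[p] (Set.range z) := by
    intro x
    obtain ⟨a, c, -, rfl⟩ := IsFractionRing.div_surjective (A := MvPolynomial I ℚ_[p]) x
    rw [map_div₀, ← hθapply, ← hθapply]
    exact div_mem (hθmem a) (hθmem c)
  letI : Algebra (FractionRing (MvPolynomial I ℚ_[p])) (IntermediateField.adjoin ℚ_[p] (Set.range z)) :=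
    ((algebraMap (FractionRing (MvPolynomial I ℚ_[p])) k').codRestrict
      (IntermediateField.adjoin ℚ_[p] (Set.range z)) hKmem).toAlgebra
  haveI : IsScalarTower (FractionRing (MvPolynomial I ℚ_[p]))
      (IntermediateField.adjoin ℚ_[p] (Set.range z)) k' :=
    IsScalarTower.of_algebraMap_eq (fun _ => rfl)
  haveI : Module.Finite (IntermediateField.adjoin ℚ_[p] (Set.range z)) k' :=
    Module.Finite.of_restrictScalars_finite (FractionRing (MvPolynomial I ℚ_[p])) _ k'
  -- a divisible point `x`
  refine ⟨fun x hx => ?_⟩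
  -- J1 (hypothesis): `A`, `x` descend to `E₀` finitely generated over `ℚ`
  obtain ⟨E₀, ⟨S, hS⟩, A₀, x₀, Φ, hΦ⟩ := hdesc k' A x
  -- J2: a finitely generated `E_J ⊇ E₀`, relatively algebraically closed in `k'`
  obtain ⟨EJ, hSEJ, hEJfg, hrac⟩ := exists_fg_intermediateField_relAlgClosed z hz S
  have hle : ∀ a : k', a ∈ E₀ → a ∈ EJ := by
    intro a ha
    have hsub : E₀.toSubfield ≤ EJ.toSubfield := by
      rw [← hS, IntermediateField.adjoin_toSubfield, Subfield.closure_le]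
      rintro b (⟨q, rfl⟩ | hb)
      · exact SubfieldClass.ratCast_mem EJ q
      · exact hSEJ hb
    exact hsub ha
  let ι₀ : E₀ →+* EJ :=
    { toFun := fun a => ⟨a.1, hle a.1 a.2⟩
      map_one' := rfl
      map_mul' := fun _ _ => rfl
      map_zero' := rfl
      map_add' := fun _ _ => rfl }
  letI : Algebra E₀ EJ := ι₀.toAlgebra
  haveI : IsScalarTower E₀ EJ k' := IsScalarTower.of_algebraMap_eq (fun _ => rfl)
  haveI : CharZero EJ := charZero_of_injective_algebraMap (algebraMap ℚ_[p] EJ).injective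
  -- `E_J` is finitely generated over `ℚ_p`, hence Kummer-faithful (Rmk. 1.5.4 (i) = F-0369)
  haveI : Algebra.EssFiniteType ℚ_[p] EJ := IntermediateField.essFiniteType_iff.mpr hEJfg
  have hKF : IsKummerFaithful EJ := isKummerFaithful_of_fg_padic p EJ (IntermediateField.fg_top ℚ_[p] EJ)
  -- the base change `A₁ := A₀ ×_{E₀} E_J`, the `E_J`-rational point `x₁`
  let A₁ : AbelianVariety EJ := A₀.baseChange EJ
  let x₁ : A₁.Points EJ := A₀.pointsEquiv EJ (extendScalars A₀.X E₀ EJ x₀)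
  have hDET : DivisibleElementsTrivial (A₁.Points EJ) :=
    hKF.abelianVariety EJ (Module.Finite.self EJ) A₁
  -- the identification `Θ : A(k') → A₁(k')`, multiplicative, with `Θ x = (x₁)_{k'}`
  let Ψ : A₀.Points k' ≃* A₁.Points k' :=
    MulEquiv.mk' (A₀.pointsEquivTower EJ k') (A₀.pointsEquivTower_mul EJ k')
  let Θ : A.Points k' →* A₁.Points k' := Ψ.toMonoidHom.comp Φ.toMonoidHom
  have hΘx : Θ x = extendScalars A₁.X EJ k' x₁ := by
    change A₀.pointsEquivTower EJ k' (Φ x) = _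
    rw [hΦ, ← AlgPoints.extendScalars_extendScalars A₀.X EJ k' x₀,
      AbelianVariety.pointsEquivTower_extendScalars]
  -- `x₁` is divisible in `A₁(E_J)`: every `k'`-rational `N`-th root of it is `E_J`-rational (J3/J4)
  have hrac' : ∀ w : k', IsAlgebraic EJ w → w ∈ Set.range (algebraMap EJ k') := by
    intro w hw
    exact ⟨⟨w, hrac w hw⟩, rfl⟩
  have hx₁ : x₁ = 1 := by
    refine hDET.eq_one_of_forall_exists_pow x₁ fun N hN => ?_
    obtain ⟨y, hy⟩ := hx N hN
    have hY : (Θ y) ^ N = extendScalars A₁.X EJ k' x₁ := by rw [← map_pow, hy, hΘx]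
    obtain ⟨Y₀, hY₀⟩ := AbelianVariety.exists_eq_extendScalars_of_pow_eq A₁ k' hrac' x₁ (Θ y) N hN hY
    refine ⟨Y₀, extendScalars_injective A₁.X EJ k' ?_⟩
    rw [← extendScalarsMonoidHom_apply, map_pow, extendScalarsMonoidHom_apply, hY₀, hY]
  -- hence `Θ x = 1` and `x = 1`
  have hΘ1 : Θ x = 1 := by
    rw [hΘx, hx₁, ← extendScalarsMonoidHom_apply, map_one]
  have hΦ1 : Φ x = 1 := by
    have : Ψ (Φ x) = Ψ 1 := by rw [map_one]; exact hΘ1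
    exact Ψ.injective this
  exact Φ.injective (hΦ1.trans (map_one Φ).symm)

/-- **[AbsTopIII] Rmk. 1.5.4 (iii) (FACT-LIST F-0371) GRANTED DESCENT**: if every abelian variety with
a rational point over a field of characteristic `0` descends (on points, multiplicatively) to a
subfield finitely generated over `ℚ` — junction J1 of route F0371-AV-ROUTE, EGA IV₃ 8.8.2 — then
`Rmk_1_5_4_iii` holds: for every prime `p` and every infinite `I`, `ℚ_p(x_i)_{i ∈ I}` is
Kummer-faithful (tree typing) and not sub-`p`-adic. The torus clause and "not sub-`p`-adic" are
`Rmk_1_5_4_iii_of_abelianVariety_clause` (`KummerFaithfulPurelyTranscendentalProofs`); the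
abelian-variety clause is `divisibleElementsTrivial_points_of_finite_mvPolynomial_of_descent`.
HONEST LABEL: conditional on `hdesc`; F-0371 is not closed by this theorem.
[cite: MochizukiAbsTopIII2015, Rmk 1.5.4 (iii) p.34] -/
theorem Rmk_1_5_4_iii_of_descent
    (hdesc : ∀ (k' : Type) [Field k'] [CharZero k'] (A : AbelianVariety k') (x : A.Points k'),
      ∃ (E₀ : IntermediateField ℚ k') (_ : E₀.FG) (A₀ : AbelianVariety E₀) (x₀ : A₀.Points E₀)
        (Φ : A.Points k' ≃* A₀.Points k'), Φ x = extendScalars A₀.X E₀ k' x₀) :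
    Rmk_1_5_4_iii :=
  Rmk_1_5_4_iii_of_abelianVariety_clause fun p _ I _ k' _ _ hfin A => by
    haveI := hfin
    exact divisibleElementsTrivial_points_of_finite_mvPolynomial_of_descent hdesc p I k' A

end Assembly

end Literature.AnabelianGeometry.AbsoluteAnabelian.AbsTopIII
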